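import Summits.BirchSwinnertonDyer.BirchSwinnertonDyer.Theorems.ResidualThetaTransportAtTwoSignedMuSeedAtTwoPlusJetLevelOneWall
import HarnessLib

/-!
# The level step `δ_m = (t ⊕ y_m) − t` HAS the wall shape `ū t^N + t^{2N}·ε` (`N = ord y_m` a power of `2`) on the tilt curve
# — discharging the `δ`-hypothesis of `…JetLevelOneWall` / `…JetLevelWall` from the tree's translation shape
# (seed line `jet-character-sums` / `norm-field-tilt`; crux `SignedMuSeedAtTwoPlus` stmt-BirchSwinnertonDyer-21438; Kμ⁺ stmt-BirchSwinnertonDyer-20689)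

Cell `bsd-wall`, width seat `bsd-wall-rtt-p4-w2` g13 (`--supports`, closes nothing).  THEOREMS ONLY; the lines are NOT registered (W-79); BSD is not
proved by this.

In the engine (`Tilt.oddDigit_of_nonDeg…`, `TiltTranslation.map_hom_one_add_pow_mul`) the level-`m` translation is `t ⊕ y_m` with
`y_m = ([w_m]‾t)^{4^{m+1}} = z^{2^n}` (`n = 2m + 2`, `z(0) = 0`), and `t ⊕ y := F̄(y, t) = t + η̄·y + y²·r` (`Tilt.exists_translate_eq`) with `η̄ = 1`
on `y² + y = x³` (`Tilt.formalEta_eq_one`).  In characteristic `2`, `z^{2^n} = [t¹]z^{2^n}·t^{2^n} + t^{2^{n+1}}·(…)` (Frobenius), so: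

* `add_pow_two_pow_charTwo` — `(a + b)^{2^n} = a^{2^n} + b^{2^n}` in `k⟦t⟧`, `char k = 2`;
* `pow_two_pow_eq_of_constantCoeff_eq_zero` — `z(0) = 0 ⟹ z^{2^n} = C(z₁^{2^n})·t^{2^n} + t^{2^{n+1}}·ρ` for some `ρ`;
* **`exists_levelStep_delta_shape`** — for the tilt curve `Ẽ = (y² + y = x³)` over `k` of characteristic `2`, `z(0) = 0`, `n ≥ 1`:
  `∃ ε, F̄(z^{2^n}, t) − t = C(z₁^{2^n})·t^{2^n} + t^{2·2^n}·ε` — EXACTLY the hypothesis `δ = C u * X ^ N + X ^ (2 * N) * ε` of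
  `coeff_levelStep_safeZone` (`N = 2^n`, `u = z₁^{2^n}`), and (with `n = 2`) `X ^ 8 ∣ δ − C u * X ^ 4` of `X_pow_fourteen_dvd_levelOne_sub`:
  `levelStep_delta_dvd`.

So every hypothesis of the wall theorems except the series `S` itself (`S₀ = Φ_ρ`, the dictionary S1 (ii)) and the identity of `ū = z₁^{N}` is now
supplied by tree objects. [folklore]
-/

set_option autoImplicit false
-- the Theorems namespace of this sub repeats the summit name by design (D-0017 nested layout)
set_option linter.dupNamespace false

noncomputable section

open PowerSeries

namespace Summit.BirchSwinnertonDyer.BirchSwinnertonDyer.Theorems.SignedMuAtTwo.JetCharacterSums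

variable {k : Type*} [CommRing k] [CharP k 2]

/-- `(a + b)^{2^n} = a^{2^n} + b^{2^n}` for power series in characteristic `2`. [folklore] -/
theorem add_pow_two_pow_charTwo (a b : k⟦X⟧) (n : ℕ) : (a + b) ^ 2 ^ n = a ^ 2 ^ n + b ^ 2 ^ n := by
  induction n with
  | zero => simp
  | succ n ih => rw [pow_succ, pow_mul, ih, add_sq_charTwo, ← pow_mul, ← pow_mul]

/-- `z(0) = 0 ⟹ z^{2^n} = C(z₁^{2^n})·t^{2^n} + t^{2^{n+1}}·ρ` in characteristic `2` (`z₁ = [t¹]z`). [folklore] -/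
theorem pow_two_pow_eq_of_constantCoeff_eq_zero {z : k⟦X⟧} (hz : constantCoeff z = 0) (n : ℕ) :
    ∃ ρ : k⟦X⟧, z ^ 2 ^ n = C (coeff 1 z ^ 2 ^ n) * X ^ 2 ^ n + X ^ 2 ^ (n + 1) * ρ := by
  -- `z = z₁·t + t²·z'`
  obtain ⟨z', hz'⟩ : (X : k⟦X⟧) ^ 2 ∣ z - C (coeff 1 z) * X := by
    refine X_pow_dvd_iff.mpr fun m hm => ?_
    interval_cases m
    · rw [map_sub, coeff_zero_eq_constantCoeff_apply, hz, coeff_zero_eq_constantCoeff_apply, map_mul, constantCoeff_X,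
        mul_zero, sub_zero]
    · rw [map_sub, coeff_C_mul, coeff_one_X, mul_one, sub_self]
  refine ⟨z' ^ 2 ^ n, ?_⟩
  have hz2 : z = C (coeff 1 z) * X + X ^ 2 * z' := by linear_combination hz'
  calc z ^ 2 ^ n = (C (coeff 1 z) * X + X ^ 2 * z') ^ 2 ^ n := by rw [← hz2]
    _ = C (coeff 1 z ^ 2 ^ n) * X ^ 2 ^ n + X ^ 2 ^ (n + 1) * z' ^ 2 ^ n := by
        rw [add_pow_two_pow_charTwo, mul_pow, mul_pow, ← map_pow, ← pow_mul, pow_succ' 2 n]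

/-- **The level step has the wall shape.**  For the tilt curve `Ẽ = (y² + y = x³)` over `k` of characteristic `2`, every `z ∈ t·k⟦t⟧` and `n`:
`∃ ε, F̄(z^{2^n}, t) − t = C(z₁^{2^n})·t^{2^n} + t^{2·2^n}·ε` (`t ⊕ y = t + y + y²r`, `η̄ = 1`, Frobenius). [folklore] -/
theorem exists_levelStep_delta_shape {z : k⟦X⟧} (hz : constantCoeff z = 0) (n : ℕ) :
    ∃ ε : k⟦X⟧, MvPowerSeries.subst ![z ^ 2 ^ n, (X : k⟦X⟧)] (⟨0, 0, 1, 0, 0⟩ : WeierstrassCurve k).formalGroupLaw - X =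
      C (coeff 1 z ^ 2 ^ n) * X ^ 2 ^ n + X ^ (2 * 2 ^ n) * ε := by
  have hy : constantCoeff (z ^ 2 ^ n) = 0 := by rw [map_pow, hz, zero_pow (pow_ne_zero n two_ne_zero)]
  obtain ⟨r, hr⟩ := Tilt.exists_translate_eq (⟨0, 0, 1, 0, 0⟩ : WeierstrassCurve k) hy
  obtain ⟨ρ, hρ⟩ := pow_two_pow_eq_of_constantCoeff_eq_zero hz n
  rw [Tilt.formalEta_eq_one _ rfl rfl rfl rfl, one_mul] at hr
  refine ⟨ρ + (C (coeff 1 z ^ 2 ^ n) + X ^ 2 ^ n * ρ) ^ 2 * r, ?_⟩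
  rw [hr, hρ, show 2 * 2 ^ n = 2 ^ (n + 1) by ring]
  ring

/-- The divisibility form used by `…JetLevelOneWall` (`n = 2`: `N = 4`, `t⁸ ∣ δ − ū t⁴`) and in general:
`t^{2N} ∣ (F̄(z^{N}, t) − t) − C(z₁^{N})·t^{N}`, `N = 2^n`. [folklore] -/
theorem levelStep_delta_dvd {z : k⟦X⟧} (hz : constantCoeff z = 0) (n : ℕ) :
    (X : k⟦X⟧) ^ (2 * 2 ^ n) ∣
      (MvPowerSeries.subst ![z ^ 2 ^ n, (X : k⟦X⟧)] (⟨0, 0, 1, 0, 0⟩ : WeierstrassCurve k).formalGroupLaw - X) -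
        C (coeff 1 z ^ 2 ^ n) * X ^ 2 ^ n := by
  obtain ⟨ε, hε⟩ := exists_levelStep_delta_shape hz n
  exact ⟨ε, by rw [hε]; ring⟩

/-- **The level-one wall with the tree's `δ`**: for the tilt curve over `k` (char `2`), `z ∈ t·k⟦t⟧` (in the line `z = [w₀]‾t`, `ū = z₁⁴ = w̄₀`)
and a level-`0` series `S` with `S' = S²`, `[t⁰]S = [t²]S = 0`:
`t¹⁴ ∣ S + S(F̄(z⁴, t)) − (z₁⁴·T₄² + z₁⁸·T₆)·t¹²`. [folklore] -/
theorem X_pow_fourteen_dvd_levelOne_sub_translate {S z : k⟦X⟧} (hR : d⁄dX k S = S * S) (h0 : coeff 0 S = 0) (h2 : coeff 2 S = 0)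
    (hz : constantCoeff z = 0) :
    (X : k⟦X⟧) ^ 14 ∣ S + S.subst (MvPowerSeries.subst ![z ^ 4, (X : k⟦X⟧)] (⟨0, 0, 1, 0, 0⟩ : WeierstrassCurve k).formalGroupLaw) -
      C (coeff 1 z ^ 4 * coeff 4 S ^ 2 + (coeff 1 z ^ 4) ^ 2 * coeff 6 S) * X ^ 12 := by
  have hδ := levelStep_delta_dvd hz 2
  rw [show (2 : ℕ) ^ 2 = 4 from rfl, show 2 * 4 = 8 from rfl] at hδ
  have h := X_pow_fourteen_dvd_levelOne_sub hR h0 h2 hδ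
  rwa [add_sub_cancel] at h

end Summit.BirchSwinnertonDyer.BirchSwinnertonDyer.Theorems.SignedMuAtTwo.JetCharacterSums

end
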